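import Literature.AlgebraicGeometry.ShimuraVarieties.UnitaryBallQuotientDatum
import HarnessLib

/-!
# A hermitian form definite at one complex embedding is anisotropic

Topic `NumberTheory/QuadraticForms`. For a commutative ring `R` with involution `σ` and a Gram matrix
`H`, the sesquilinear form `⟪u, v⟫_H = (σ ∘ u) ⬝ᵥ (H *ᵥ v)` is the tree's
`Literature.AlgebraicGeometry.ShimuraVarieties.hermForm σ H`. This file records:

* `Landherr.comp_mulVec`, `Landherr.hermForm_mulVec_mulVec` — transport of the form under a change of
  coordinates, `⟪g u, g v⟫_H = ⟪u, v⟫_{ᵗ(σg) · H · g}`;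
* `Landherr.mulVec_ne_zero` — an invertible change of coordinates kills no non-zero vector;
* `Landherr.eq_zero_of_posDef_map` — **definite somewhere ⇒ anisotropic**: if `τ : R →+* ℂ` intertwines
  `σ` with complex conjugation and the complex hermitian matrix `τ(H)` is positive definite
  (`Matrix.PosDef`), then `⟪x, x⟫_H = 0` forces `x = 0` (apply `τ`: `τ⟪x, x⟫_H = (τx)ᴴ · τ(H) · τx`,
  `map_hermForm`); `Landherr.not_exists_isotropic_of_posDef_map`;
* the CM-field specialisations `Landherr.eq_zero_of_posDef_map_complexConj` /
  `Landherr.not_exists_isotropic_of_posDef_map_complexConj` (`σ` = `IsCMField.complexConj L`, any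
  complex embedding `τ`, using Mathlib's `IsCMField.complexEmbedding_complexConj`).

In Landherr's classification this is the trivial direction of the isotropy criterion: a hermitian space
over a CM field `L` that is definite at some infinite place of `L⁺` has no isotropic vector.

Provenance: `pub-hodgecm` package file `Proofs/LandherrIsotropy.lean` §0 (gen 9), generalised from the
package's CM-field carrier to an arbitrary involution and ported to tree vocabulary.

## References

* W. Scharlau, *Quadratic and Hermitian Forms*, Grundlehren 270 (1985), Ch. 7 §6, Ch. 10
  [Scharlau1985HermitianForms].
* N. Bergeron, J. Millson, C. Moeglin, *The Hodge conjecture and arithmetic quotients of complex balls*,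
  Acta Math. 216 (2016), Part 2 §1.1 [BergeronMillsonMoeglin2016Balls].
-/

noncomputable section

open NumberField
open scoped Matrix ComplexOrder
open Literature.AlgebraicGeometry.ShimuraVarieties (hermForm map_hermForm hermForm_starRingEnd)

namespace Literature.NumberTheory.QuadraticForms

namespace Landherr

section CommRing

variable {R : Type} [CommRing R] {m : Type} [Fintype m]

/-- Applying `σ` to the coordinates of `g u` gives `σ(g) (σ u)`. [folklore] -/
theorem comp_mulVec (σ : R →+* R) (g : Matrix m m R) (u : m → R) :
    (σ ∘ (g *ᵥ u)) = g.map σ *ᵥ (σ ∘ u) :=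
  funext fun i => RingHom.map_mulVec σ g u i

/-- **Transport of the form under a change of coordinates**: `⟪g u, g v⟫_H = ⟪u, v⟫_{ᵗ(σg) · H · g}`.
[folklore] -/
theorem hermForm_mulVec_mulVec (σ : R →+* R) (H g : Matrix m m R) (u v : m → R) :
    hermForm σ H (g *ᵥ u) (g *ᵥ v) = hermForm σ ((g.map σ)ᵀ * H * g) u v := by
  unfold hermForm
  rw [comp_mulVec, ← Matrix.vecMul_transpose, ← Matrix.dotProduct_mulVec, Matrix.mulVec_mulVec,
    Matrix.mulVec_mulVec, Matrix.mul_assoc]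

end CommRing

section Field

variable {K : Type} [Field K] {m : Type} [Fintype m]

/-- An invertible change of coordinates kills no non-zero vector. [folklore] -/
theorem mulVec_ne_zero [DecidableEq m] (g : GL m K) {y : m → K} (hy : y ≠ 0) :
    (g : Matrix m m K) *ᵥ y ≠ 0 := by
  intro h
  apply hy
  calc y = ((g⁻¹ : GL m K) : Matrix m m K) *ᵥ ((g : Matrix m m K) *ᵥ y) := by
          rw [Matrix.mulVec_mulVec, ← Units.val_mul, inv_mul_cancel, Units.val_one, Matrix.one_mulVec]
    _ = 0 := by rw [h, Matrix.mulVec_zero]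

/-- **Definite somewhere ⇒ anisotropic.** If `τ : K →+* ℂ` intertwines the involution `σ` with complex
conjugation and the Gram matrix `H` is positive definite at `τ` (as the complex hermitian matrix `τ(H)`),
then `⟪x, x⟫_H = 0` forces `x = 0`: apply `τ` and use `τ⟪x, x⟫_H = (τx)ᴴ · τ(H) · (τx)`
(`map_hermForm`). [folklore] -/
theorem eq_zero_of_posDef_map {σ : K →+* K} (τ : K →+* ℂ) (hτ : ∀ x, τ (σ x) = starRingEnd ℂ (τ x))
    (H : Matrix m m K) (hH : (H.map τ).PosDef) {x : m → K} (hx : hermForm σ H x x = 0) : x = 0 := by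
  by_contra hne
  have hne' : (τ ∘ x) ≠ 0 := by
    intro h0
    apply hne
    funext i
    exact (map_eq_zero τ).mp (congrFun h0 i)
  have hpos := hH.dotProduct_mulVec_pos hne'
  have hmap := map_hermForm τ hτ H x x
  rw [hx, map_zero, hermForm_starRingEnd] at hmap
  rw [← hmap] at hpos
  exact lt_irrefl _ hpos

/-- The same, as the absence of isotropic vectors. [folklore] -/
theorem not_exists_isotropic_of_posDef_map {σ : K →+* K} (τ : K →+* ℂ)
    (hτ : ∀ x, τ (σ x) = starRingEnd ℂ (τ x)) (H : Matrix m m K) (hH : (H.map τ).PosDef) :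
    ¬ ∃ x : m → K, x ≠ 0 ∧ hermForm σ H x x = 0 :=
  fun ⟨_, hx, h0⟩ => hx (eq_zero_of_posDef_map τ hτ H hH h0)

end Field

section CM

variable (L : Type) [Field L] [NumberField L] [IsCMField L] {m : Type} [Fintype m]

/-- Every complex embedding of a CM field intertwines `IsCMField.complexConj` with complex conjugation
(Mathlib's `IsCMField.complexEmbedding_complexConj`, restated for the ring-hom coercion used by
`hermForm`). [folklore] -/
theorem embedding_complexConj_ringHom (τ : L →+* ℂ) (x : L) :
    τ ((IsCMField.complexConj L : L →+* L) x) = starRingEnd ℂ (τ x) :=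
  IsCMField.complexEmbedding_complexConj L τ x

/-- **Definite at one place ⇒ anisotropic, CM version**: a `σ`-hermitian Gram matrix over a CM field that
is positive definite at some complex embedding has only the zero vector of length `0`. [folklore] -/
theorem eq_zero_of_posDef_map_complexConj (H : Matrix m m L) (τ : L →+* ℂ) (hH : (H.map τ).PosDef)
    {x : m → L} (hx : hermForm (IsCMField.complexConj L : L →+* L) H x x = 0) : x = 0 :=
  eq_zero_of_posDef_map τ (embedding_complexConj_ringHom L τ) H hH hx

/-- The same, as the absence of isotropic vectors. [folklore] -/
theorem not_exists_isotropic_of_posDef_map_complexConj (H : Matrix m m L) (τ : L →+* ℂ)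
    (hH : (H.map τ).PosDef) :
    ¬ ∃ x : m → L, x ≠ 0 ∧ hermForm (IsCMField.complexConj L : L →+* L) H x x = 0 :=
  not_exists_isotropic_of_posDef_map τ (embedding_complexConj_ringHom L τ) H hH

end CM

end Landherr

end Literature.NumberTheory.QuadraticForms

end
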